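import Summits.CriticalPhenomena.PercolationContinuityZ3.Theorems.PercNearOneGluingNoHeavyLowerTailSahiGridPatternThreeCoord

/-!
# `NoHeavyLowerTail` (crux stmt-CriticalPhenomena-4575), Sahi programme: **SAHI'S `C₃` WITH ONE THREE-COORDINATE SLOT ON EVERY GRID,
# EVERY PRODUCT WEIGHT, EVERY DIMENSION** (localisation of `sStarD_nonneg_of_depOn3`)

Support file (seat `prim-sahi-p1`, generation 11; `--supports stmt-CriticalPhenomena-4575`).  Pure proofs, no definitions, no `sorry`,
standard axioms.  Vocabulary of `…SahiGridPattern` (`Xd`, `Pd`, `Ssym`, `Tmap`, `pb`, `latticeE3_symm`) and `…SahiGridPatternThreeCoord`.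

For a product weight `w = ⊗_a g_a ≥ 0` on the grid `[K+1]^d` and up-sets (increasing events) `A, B, C`, Sahi's third-order functional of the
indicators in homogeneous form is `latticeE3 w A B C = Z³·E₃(1_A,1_B,1_C)`.  THEOREM (`latticeE3_gridProd_nonneg_depOn3`,
`sahiE_three_depOn3_nonneg`): if `A` is measurable with respect to at most THREE coordinates (`B, C` arbitrary increasing events), then
`E₃(1_A,1_B,1_C) ≥ 0` — indeed coefficientwise in the chain weights (`Ssym_nonneg_depOn3`: the symmetrised pattern value at every three-point
sample is `≥ 0`).  This is Sahi 2008 Conj. 5 / Kahn's Conjecture 5 at `n = 3` on every finite grid when one event is a `3`-junta; generation 10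
had `≤ 2` coordinates (`sahiE_three_depOn_nonneg`). [this work]
-/

namespace Summit.CriticalPhenomena.PercolationContinuityZ3.Theorems.SahiGridPattern

open Finset Literature.Probability.LatticeModels Literature.Combinatorics.Sahi2008
open SahiGrid3 (ind hZ latticeE3_eq_sum_copies)
open scoped BigOperators

noncomputable section

variable {d K : ℕ}

/-- **The symmetrised pattern value of (three-coordinate up-set, up-set, up-set) is nonnegative** at every three-point sample `ω` of the grid
`[K+1]^d`. [this work] -/
theorem Ssym_nonneg_depOn3 (J : Finset (Fin d)) (hJ : J.card ≤ 3) {A B C : Finset (Xd d K)} (hA : IsUpperSet (A : Set (Xd d K)))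
    (hdep : ∀ x y : Xd d K, (∀ a ∈ J, x a = y a) → (x ∈ A ↔ y ∈ A))
    (hB : IsUpperSet (B : Set (Xd d K))) (hC : IsUpperSet (C : Set (Xd d K))) (ω : Fin 3 → Xd d K) :
    0 ≤ Ssym A B C ω := by
  let σ : Fin d → Equiv.Perm (Fin 3) := fun a => Tuple.sort fun c => ω c a
  have hsort : ∀ a, Monotone fun c => Tmap σ ω c a := fun a => by
    show Monotone ((fun c => ω c a) ∘ σ a)
    exact Tuple.monotone_sort _
  rw [← S_Tmap A B C σ ω, S_eq_sStarD]
  set ω' : Fin 3 → Xd d K := Tmap σ ω with hω'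
  have hdep' : ∀ p q : Pd d, (∀ a ∈ J, p a = q a) → (p ∈ pb ω' A ↔ q ∈ pb ω' A) := by
    intro p q hpq
    unfold pb
    rw [Finset.mem_filter, Finset.mem_filter]
    simp only [Finset.mem_univ, true_and]
    refine hdep _ _ fun a ha => ?_
    show ω' (p a) a = ω' (q a) a
    rw [hpq a ha]
  exact sStarD_nonneg_of_depOn3 J hJ (isUpperSet_pb hsort hA) hdep' _ _ (isUpperSet_pb hsort hB) (isUpperSet_pb hsort hC)

/-- **SAHI'S `C₃` WITH ONE THREE-COORDINATE SLOT ON EVERY GRID, homogeneous form** (every `d`, `K`): for every nonnegative product weight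
`w = ⊗_a g_a` on `[K+1]^d`, every up-set `A` depending on at most three coordinates and all up-sets `B, C`: `0 ≤ latticeE3 w A B C`. [this work] -/
theorem latticeE3_gridProd_nonneg_depOn3 (g : Fin d → Fin (K + 1) → ℝ) (hg : ∀ a u, 0 ≤ g a u)
    (J : Finset (Fin d)) (hJ : J.card ≤ 3) {A B C : Finset (Xd d K)} (hA : IsUpperSet (A : Set (Xd d K)))
    (hdep : ∀ x y : Xd d K, (∀ a ∈ J, x a = y a) → (x ∈ A ↔ y ∈ A))
    (hB : IsUpperSet (B : Set (Xd d K))) (hC : IsUpperSet (C : Set (Xd d K))) :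
    0 ≤ latticeE3 (fun ω : Xd d K => ∏ a, g a (ω a)) A B C := by
  have hcard : (0 : ℝ) < Fintype.card (Fin d → Equiv.Perm (Fin 3)) := by exact_mod_cast Fintype.card_pos
  have h := latticeE3_symm g A B C
  have hsum : 0 ≤ ∑ ω : Fin 3 → Xd d K, (∏ c, ∏ a, g a (ω c a)) * (Ssym A B C ω : ℝ) :=
    Finset.sum_nonneg fun ω _ => mul_nonneg (Finset.prod_nonneg fun c _ => Finset.prod_nonneg fun a _ => hg a _)
      (by exact_mod_cast Ssym_nonneg_depOn3 J hJ hA hdep hB hC ω)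
  rw [← h] at hsum
  exact (mul_nonneg_iff_of_pos_left hcard).1 hsum

/-- **SAHI'S `C₃` WITH ONE THREE-COORDINATE SLOT ON EVERY GRID, probability form** (every `d`, `K`): for every product probability weight on
`[K+1]^d`, every increasing event `A` depending on at most three coordinates and all increasing events `B, C`: `0 ≤ E₃(1_A, 1_B, 1_C)`.
[this work] -/
theorem sahiE_three_depOn3_nonneg (g : Fin d → Fin (K + 1) → ℝ) (hg0 : ∀ i u, 0 ≤ g i u) (hg1 : ∀ i, ∑ u, g i u = 1)
    (J : Finset (Fin d)) (hJ : J.card ≤ 3) {A B C : Finset (Xd d K)} (hA : IsUpperSet (A : Set (Xd d K)))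
    (hdep : ∀ x y : Xd d K, (∀ a ∈ J, x a = y a) → (x ∈ A ↔ y ∈ A))
    (hB : IsUpperSet (B : Set (Xd d K))) (hC : IsUpperSet (C : Set (Xd d K))) :
    0 ≤ sahiE (fun ω : Xd d K => ∏ i, g i (ω i)) 3 ![setInd A, setInd B, setInd C] := by
  classical
  have hsum : ∑ ω : Fin d → Fin (K + 1), ∏ i, g i (ω i) = 1 := by
    rw [← Fintype.prod_sum]; simp [hg1]
  rw [sahiE_three_indicator_eq_latticeE3 hsum]
  exact latticeE3_gridProd_nonneg_depOn3 g hg0 J hJ hA hdep hB hC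

/-- **Example**: the increasing event `{x : s ≤ x i ∨ (t ≤ x j ∧ u ≤ x l)}` depends only on `{i, j, l}`, so for every product probability weight
and all increasing `B, C`: `0 ≤ E₃(1_{x_i ≥ s ∨ (x_j ≥ t ∧ x_l ≥ u)}, 1_B, 1_C)`. [this work] -/
theorem sahiE_three_orAnd_nonneg (g : Fin d → Fin (K + 1) → ℝ) (hg0 : ∀ i u, 0 ≤ g i u) (hg1 : ∀ i, ∑ u, g i u = 1)
    (i j l : Fin d) (s t u : Fin (K + 1)) {B C : Finset (Xd d K)} (hB : IsUpperSet (B : Set (Xd d K))) (hC : IsUpperSet (C : Set (Xd d K))) :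
    0 ≤ sahiE (fun ω : Xd d K => ∏ i, g i (ω i)) 3
      ![setInd (univ.filter fun x : Xd d K => s ≤ x i ∨ (t ≤ x j ∧ u ≤ x l)), setInd B, setInd C] := by
  classical
  refine sahiE_three_depOn3_nonneg g hg0 hg1 ({i, j, l} : Finset (Fin d)) Finset.card_le_three ?_ ?_ hB hC
  · intro x y hxy hx
    rw [Finset.mem_coe, Finset.mem_filter] at hx ⊢
    refine ⟨Finset.mem_univ _, ?_⟩
    rcases hx.2 with h | h
    · exact Or.inl (le_trans h (hxy i))
    · exact Or.inr ⟨le_trans h.1 (hxy j), le_trans h.2 (hxy l)⟩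
  · intro x y hxy
    rw [Finset.mem_filter, Finset.mem_filter]
    simp only [Finset.mem_univ, true_and]
    rw [hxy i (by simp), hxy j (by simp), hxy l (by simp)]

end

end Summit.CriticalPhenomena.PercolationContinuityZ3.Theorems.SahiGridPattern
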